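import Summits.AtomisticToContinuum.BoseEinsteinCondensation.Theorems.BECThomsonPrincipleFibreConductanceCageDefs
import Literature.MathematicalPhysics.QuantumManyBody.PeriodicHeatFlowSpectral
import Literature.MathematicalPhysics.QuantumManyBody.PeriodicFeynmanKacSymmetry
import HarnessLib

/-!
# Route `BECThomsonPrinciple`, crux `FibreConductance` (stmt-AtomisticToContinuum-9480), line
# `tagged-path-harnack-cage-moments`: prerequisite (H2) of the lever `stub_shiftHarnack` —
# one-time marginals of the stationary ground-state path law are Born

Helper file for the registered stub `stub_shiftHarnack : Goal.stub_shiftHarnack`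
(`ShiftHarnack := LocalNumberExpMoments → BallHarnackMoment`). Step (3)–(4) of the paper proof of the
lever takes Born moments through the STATIONARY ground-state path law
`P^{stat}(dX dω) = Ψ₀(X) e^{E₀T} e^{-∫₀ᵀ∑v^per(B_s)ds} Ψ₀(B_T) dW_X(ω) dX` on `cell × paths` and uses that
its one-time marginals are the Born law `Ψ₀² dX` ("Jensen in time + stationarity reduce the
interaction factor to `LocalNumberExpMoments` (ii)"). This file proves exactly that, for any witness
`Ψ₀` of `IsPeriodicGroundStateFK v L` (by (H1), file `…StubShiftHarnackGroundState.lean`, the modulus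
of the crux's exact minimiser is one):

* `lintegral_periodicFKWeight_mul_mul` — the **two-time Markov property** of the periodic
  Feynman–Kac functional: `E_X[w_{s+t} h(B_s) g(B_{s+t})] = (e^{-sH}(h · e^{-tH}g))(X)` for measurable
  `h, g ≥ 0` (the tree's `periodicFKSemigroup_add` is the case `h = 1`; same proof: the Markov
  factorisation `lintegral_comp_pathsShift_eq` applied to the raw functional
  `w ↦ h(B_s) e^{-∫₀ᵗV^per} g(B_t)` started from `B_s`);
* `setLIntegral_cellN_groundState_mul_periodicFKSemigroup_mul` — the **endpoint marginal**:
  `∫_cell Ψ₀ · e^{-TH}(Ψ₀ F) = e^{-E₀T} ∫_cell Ψ₀² F` (symmetry of the semigroup on the cell,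
  `setLIntegral_cellN_mul_periodicFKSemigroup_comm`, and the eigen-relation);
* `setLIntegral_cellN_groundState_stationary_marginal` — the **one-time marginal at any
  `s ∈ [0, T]`**: `∫_cell Ψ₀(X) E_X[w_T h(B_s) Ψ₀(B_T)] dX = e^{-E₀T} ∫_cell Ψ₀² h`, i.e.
  `E^{stat}[h(B_s)] = ∫_cell Ψ₀² h` after the normalisation `e^{E₀T}`.

References: Chung–Zhao (1995) §3.2 (26), Thm 3.10 [ChungZhao1995]; Kipnis–Varadhan (1986) (stationary
Markov processes started from the invariant law) [KipnisVaradhan1986].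
-/

noncomputable section

namespace Summit.AtomisticToContinuum.BoseEinsteinCondensation.Cruxes.FibreConductance.TaggedPathHarnack

open MeasureTheory Filter
open scoped ENNReal NNReal Topology
open Literature.MathematicalPhysics.QuantumManyBody.BoseGas
open Literature.Probability.Process

variable {N : ℕ} {L : ℝ} {v : ℝ → ℝ≥0∞}

/-! ## The two-time Markov property of the periodic Feynman–Kac functional -/

/-- **Two-time Markov property** (`ℝ≥0` times): for measurable `v`, `h`, `g` and every `X`,
`E_X[w_{s+t} · h(B_s) · g(B_{s+t})] = (e^{-sH}(h · e^{-tH} g))(X)`, `w` the periodic Feynman–Kac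
weight — the Markov property of the world-lines at time `s` (`lintegral_comp_pathsShift_eq`) applied
to the raw functional `w ↦ h(Y) e^{-∫₀ᵗ V^per} g(B_t)` started from `Y = B_s`. [folklore] -/
theorem lintegral_periodicFKWeight_mul_mul_nnreal (hv : Measurable v) (L : ℝ) (s t : ℝ≥0)
    {h g : Config N → ℝ≥0∞} (hh : Measurable h) (hg : Measurable g) (X : Config N) :
    ∫⁻ ω, periodicFKWeight v L ((s : ℝ) + t) X ω * h (worldLine X ω s) *
        g (worldLine X ω (s + t)) ∂wienerPaths N =
      periodicFKSemigroup v L s (fun Y => h Y * periodicFKSemigroup v L t g Y) X := by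
  -- measurability of the raw functional
  -- `G((a, Y), w) = a · h(Y) · rawWeight t Y w · g(rawWorldLine Y w t)`
  have hGm : Measurable fun q : (ℝ≥0∞ × Config N) × PathSpace N =>
      q.1.1 * h q.1.2 * ((fun p : Config N × PathSpace N => expNeg (∫⁻ r in Set.Ioc (0 : ℝ) t,
        periodicInteraction v L (fun i : Fin N => p.1 i + WithLp.toLp 2 (fun k : Fin 3 =>
          Real.sqrt 2 * pathRegularize (p.2 i k) r.toNNReal)))) (q.1.2, q.2) *
        g (fun i : Fin N => q.1.2 i + WithLp.toLp 2 (fun k : Fin 3 =>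
          Real.sqrt 2 * pathRegularize (q.2 i k) t))) := by
    have hπ : Measurable fun q : (ℝ≥0∞ × Config N) × PathSpace N => (q.1.2, q.2) :=
      (measurable_snd.comp measurable_fst).prodMk measurable_snd
    refine ((measurable_fst.comp measurable_fst).mul
      (hh.comp (measurable_snd.comp measurable_fst))).mul ?_
    exact ((measurable_rawPeriodicWeight N hv L t).comp hπ).mul
      (hg.comp ((measurable_rawWorldLine_at' N t).comp hπ))
  have key := lintegral_comp_pathsShift_eq N s
    (measurable_comap_past_periodicFKWeight_worldLine hv L s X) hGm
  have hfold : ∀ (Y : Config N) (ω' : PathSpace N),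
      expNeg (∫⁻ r in Set.Ioc (0 : ℝ) t, periodicInteraction v L (worldLine Y ω' r.toNNReal)) =
        periodicFKWeight v L t Y ω' := fun _ _ => rfl
  simp only [raw_worldLine_pathsShift, raw_worldLine_pathsPath, hfold] at key
  -- the left-hand side: split the weight at time `s`
  have hl : ∀ ω, periodicFKWeight v L ((s : ℝ) + t) X ω * h (worldLine X ω s) *
      g (worldLine X ω (s + t)) =
      periodicFKWeight v L s X ω * h (worldLine X ω s) *
        (expNeg (∫⁻ r in Set.Ioc (0 : ℝ) t,
          periodicInteraction v L (worldLine X ω (s + r.toNNReal))) *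
        g (worldLine X ω (s + t))) := fun ω => by
    rw [periodicFKWeight_add_eq_mul v L s t X ω]; ring
  simp_rw [hl]
  rw [key]
  -- the right-hand side: pull the past factors out of the inner expectation
  simp only [periodicFKSemigroup, Real.toNNReal_coe]
  refine lintegral_congr fun ω => ?_
  have hinner : Measurable fun ω' : PathSpace N =>
      periodicFKWeight v L t (worldLine X ω s) ω' * g (worldLine (worldLine X ω s) ω' t) :=
    (measurable_periodicFKWeight hv L t _).mul (hg.comp (measurable_worldLine _ t))
  rw [lintegral_const_mul _ hinner, mul_assoc]

/-- **Two-time Markov property** (real times `s, t ≥ 0`): for measurable `v`, `h`, `g` and every `X`,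
`E_X[w_{s+t} · h(B_s) · g(B_{s+t})] = (e^{-sH}(h · e^{-tH} g))(X)`. [folklore] -/
theorem lintegral_periodicFKWeight_mul_mul (hv : Measurable v) (L : ℝ) {s t : ℝ} (hs : 0 ≤ s)
    (ht : 0 ≤ t) {h g : Config N → ℝ≥0∞} (hh : Measurable h) (hg : Measurable g) (X : Config N) :
    ∫⁻ ω, periodicFKWeight v L (s + t) X ω * h (worldLine X ω s.toNNReal) *
        g (worldLine X ω (s + t).toNNReal) ∂wienerPaths N =
      periodicFKSemigroup v L s (fun Y => h Y * periodicFKSemigroup v L t g Y) X := by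
  lift s to ℝ≥0 using hs
  lift t to ℝ≥0 using ht
  have e : ((s : ℝ) + t).toNNReal = s + t := by rw [← NNReal.coe_add, Real.toNNReal_coe]
  rw [Real.toNNReal_coe, e]
  exact lintegral_periodicFKWeight_mul_mul_nnreal hv L s t hh hg X

/-! ## One-time marginals of the stationary ground-state path law are Born -/

/-- **Endpoint marginal of the stationary path law.** For a witness `Ψ₀` of
`IsPeriodicGroundStateFK v L` (`v` measurable, `L > 0`), `T ≥ 0` and a periodic measurable
`F : (ℝ³)^N → [0, ∞]`: `∫_cell Ψ₀ · e^{-TH}(Ψ₀ F) = e^{-E₀T} ∫_cell Ψ₀² F` — the symmetry of the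
periodic Feynman–Kac semigroup on the cell (`setLIntegral_cellN_mul_periodicFKSemigroup_comm`) and
the eigen-relation `e^{-TH}Ψ₀ = e^{-E₀T}Ψ₀`. Equivalently `E^{stat}[F(B_T)] = ∫_cell Ψ₀² F`.
[cite: ChungZhao1995, Thm 3.10] -/
theorem setLIntegral_cellN_groundState_mul_periodicFKSemigroup_mul (hv : Measurable v) (hL : 0 < L)
    {Ψ₀ : Config N → ℝ} (hΨ : IsPeriodicGroundStateFK v L Ψ₀) {T : ℝ} (hT : 0 ≤ T)
    {F : Config N → ℝ≥0∞} (hF : Measurable F)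
    (hFper : ∀ (X : Config N) (i : Fin N) (k : Fin 3),
      F (X + Pi.single i (EuclideanSpace.single k L)) = F X) :
    ∫⁻ X in cellN N L, ENNReal.ofReal (Ψ₀ X) *
        periodicFKSemigroup v L T (fun Y => ENNReal.ofReal (Ψ₀ Y) * F Y) X =
      ENNReal.ofReal (Real.exp (-((periodicGroundStateEnergy v N L).toReal * T))) *
        ∫⁻ X in cellN N L, ENNReal.ofReal (Ψ₀ X) ^ 2 * F X := by
  have hΨm : Measurable fun Y => ENNReal.ofReal (Ψ₀ Y) := hΨ.measurable.ennreal_ofReal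
  rw [setLIntegral_cellN_mul_periodicFKSemigroup_comm hv hL hT
    (f := fun Y => ENNReal.ofReal (Ψ₀ Y)) (g := fun Y => ENNReal.ofReal (Ψ₀ Y) * F Y) hΨm
    (hΨm.mul hF) hΨ.ofReal_periodic (fun X i k => by simp only [hΨ.periodic, hFper])]
  have hpt : ∀ X, ENNReal.ofReal (Ψ₀ X) * F X *
      periodicFKSemigroup v L T (fun Y => ENNReal.ofReal (Ψ₀ Y)) X =
      ENNReal.ofReal (Real.exp (-((periodicGroundStateEnergy v N L).toReal * T))) *
        (ENNReal.ofReal (Ψ₀ X) ^ 2 * F X) := fun X => by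
    rw [hΨ.eigen T hT X, ENNReal.ofReal_mul (Real.exp_pos _).le]; ring
  simp_rw [hpt]
  have hmeas : Measurable fun X => ENNReal.ofReal (Ψ₀ X) ^ 2 * F X := (hΨm.pow_const 2).mul hF
  rw [lintegral_const_mul _ hmeas]

/-- **One-time marginals of the stationary ground-state path law are Born.** For a witness `Ψ₀` of
`IsPeriodicGroundStateFK v L` (`v` measurable, `L > 0`), times `0 ≤ s`, `0 ≤ t` (horizon `T = s + t`)
and a periodic measurable `h : (ℝ³)^N → [0, ∞]`:
`∫_cell Ψ₀(X) E_X[w_{s+t} h(B_s) Ψ₀(B_{s+t})] dX = e^{-E₀(s+t)} ∫_cell Ψ₀² h`. With the normalisation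
`e^{E₀T}` of the stationary law `P^{stat}(dX dω) = Ψ₀(X)e^{E₀T}w_T Ψ₀(B_T) dW_X dX` this reads
`E^{stat}[h(B_s)] = ∫_cell Ψ₀² h` for every `s ∈ [0, T]` (two-time Markov property, eigen-relation
at the later time, endpoint marginal at the earlier time). [cite: ChungZhao1995, Thm 3.10] -/
theorem setLIntegral_cellN_groundState_stationary_marginal (hv : Measurable v) (hL : 0 < L)
    {Ψ₀ : Config N → ℝ} (hΨ : IsPeriodicGroundStateFK v L Ψ₀) {s t : ℝ} (hs : 0 ≤ s) (ht : 0 ≤ t)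
    {h : Config N → ℝ≥0∞} (hh : Measurable h)
    (hper : ∀ (X : Config N) (i : Fin N) (k : Fin 3),
      h (X + Pi.single i (EuclideanSpace.single k L)) = h X) :
    ∫⁻ X in cellN N L, ENNReal.ofReal (Ψ₀ X) *
        ∫⁻ ω, periodicFKWeight v L (s + t) X ω * h (worldLine X ω s.toNNReal) *
          ENNReal.ofReal (Ψ₀ (worldLine X ω (s + t).toNNReal)) ∂wienerPaths N =
      ENNReal.ofReal (Real.exp (-((periodicGroundStateEnergy v N L).toReal * (s + t)))) *
        ∫⁻ X in cellN N L, ENNReal.ofReal (Ψ₀ X) ^ 2 * h X := by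
  have hΨm : Measurable fun Y => ENNReal.ofReal (Ψ₀ Y) := hΨ.measurable.ennreal_ofReal
  -- two-time Markov and the eigen-relation at the later time
  have hin : ∀ X, ∫⁻ ω, periodicFKWeight v L (s + t) X ω * h (worldLine X ω s.toNNReal) *
      ENNReal.ofReal (Ψ₀ (worldLine X ω (s + t).toNNReal)) ∂wienerPaths N =
      ENNReal.ofReal (Real.exp (-((periodicGroundStateEnergy v N L).toReal * t))) *
        periodicFKSemigroup v L s (fun Y => ENNReal.ofReal (Ψ₀ Y) * h Y) X := by
    intro X
    rw [lintegral_periodicFKWeight_mul_mul hv L hs ht hh hΨm X]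
    have hpt : ∀ Y, h Y * periodicFKSemigroup v L t (fun Z => ENNReal.ofReal (Ψ₀ Z)) Y =
        ENNReal.ofReal (Real.exp (-((periodicGroundStateEnergy v N L).toReal * t))) *
          (ENNReal.ofReal (Ψ₀ Y) * h Y) := fun Y => by
      rw [hΨ.eigen t ht Y, ENNReal.ofReal_mul (Real.exp_pos _).le]; ring
    simp_rw [hpt]
    -- pull the constant out of the functional
    simp only [periodicFKSemigroup]
    have hmeas : Measurable fun ω : PathSpace N => periodicFKWeight v L s X ω *
        (ENNReal.ofReal (Ψ₀ (worldLine X ω s.toNNReal)) * h (worldLine X ω s.toNNReal)) :=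
      (measurable_periodicFKWeight hv L s X).mul
        ((hΨm.mul hh).comp (measurable_worldLine X _))
    rw [← lintegral_const_mul _ hmeas]
    refine lintegral_congr fun ω => ?_
    ring
  simp_rw [hin]
  have hpt2 : ∀ X, ENNReal.ofReal (Ψ₀ X) *
      (ENNReal.ofReal (Real.exp (-((periodicGroundStateEnergy v N L).toReal * t))) *
        periodicFKSemigroup v L s (fun Y => ENNReal.ofReal (Ψ₀ Y) * h Y) X) =
      ENNReal.ofReal (Real.exp (-((periodicGroundStateEnergy v N L).toReal * t))) *
        (ENNReal.ofReal (Ψ₀ X) *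
          periodicFKSemigroup v L s (fun Y => ENNReal.ofReal (Ψ₀ Y) * h Y) X) := fun X => by ring
  simp_rw [hpt2]
  have hmeas2 : Measurable fun X => ENNReal.ofReal (Ψ₀ X) *
      periodicFKSemigroup v L s (fun Y => ENNReal.ofReal (Ψ₀ Y) * h Y) X :=
    hΨm.mul (measurable_periodicFKSemigroup hv L s (hΨm.mul hh))
  rw [lintegral_const_mul _ hmeas2,
    setLIntegral_cellN_groundState_mul_periodicFKSemigroup_mul hv hL hΨ hs hh hper, ← mul_assoc,
    ← ENNReal.ofReal_mul (Real.exp_pos _).le, ← Real.exp_add]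
  congr 3; ring

end Summit.AtomisticToContinuum.BoseEinsteinCondensation.Cruxes.FibreConductance.TaggedPathHarnack

end
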